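/-
Origin: expansion seat `planner-pub-hodgecm-toy2-g5-0`, handover #9 2026-08-18T09:20:20Z (`HOME/pub-hodgecm-toy2-g5/lean/Toy2g5/PadH0FundDescent.lean`, md5 c2cf7907, 183 lines);
landed by the gen-7 packager in gate run 27 as `HodgeCM/Model/PadH0FundDescent.lean` (import ^import Toy2g5\.PadH0Fund\b→import HodgeCM.Model.PadH0Fund ×1; stripped 5 #print/#check/#eval lines).
-/
/-
Copyright: pub-hodgecm formalisation cell (harness21, 2026). New file (not vendored).
Origin: HOME/pub-hodgecm-toy2-g5/lean/Toy2g5/PadH0FundDescent.lean — session planner-pub-hodgecm-toy2-g5-0 (unit pub-hodgecm-toy2-g5,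
CONSISTENCY seat 2, part (6a)(ii), generation 5).  WIP module `Toy2g5.PadH0FundDescent`; intended final place
`HodgeCM/Model/PadH0FundDescent.lean` (module `HodgeCM.Model.PadH0FundDescent`).  ONE import to rewrite on landing:
`Toy2g5.PadH0Fund` ↦ `HodgeCM.Model.PadH0Fund`.
-/
import Summits.HodgeConjecture.HodgeCM.Model.PadH0Fund
import Summits.HodgeConjecture.HodgeCM.StubTree.Qw8GysinDescentH0

/-!
# The degree-0 inputs of the [QW8] route fail in `U♭⁰`: F7d `Fact_gysinDescent` (M41), F7d-B, `Fact_unitH0`; F7 with nonzero traces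

Continuation of `HodgeCM.Model.PadH0Fund` (`U♭⁰ := U.padH0 U.padDatumH0`, the pad = a second copy of `H⁰` of type
`(0,0)`).  Besides N5 `Fact_fundClass` and the degree-0 residue `Qw8MilneZero`, the OTHER inputs by which the certified
[QW8]-side assemblies reach degree `0` fail in `U♭⁰` as well, for the same reason (cup products and traces of `U♭⁰` kill
the pad, so nothing "descends" to a pad vector):

* `not_fact_unitH0` — **`Fact_unitH0` fails** (`H♭⁰(A′) = H⁰(A′) ⊕ H⁰(A′)` is not a line) as soon as some `H⁰(A′, ℚ) ≠ 0`;
* `not_fact_gysinDescent`, `not_fact_gysinDescentB` — **F7d = M41 `Fact_gysinDescent` and its clause (b) `Fact_gysinDescentB`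
  fail**, given `ModelAxioms ∧ Fact_dimProd` (block projections exist in `U♭⁰`), some `H⁰(A′, ℚ) ≠ 0` and some nonzero
  rational top class `ω` on some block `Y′` (in `U`): `p_Y^*(0,u) ∪ p_{Y′}^*ω = 0` although `(0,u) ≠ 0`, and `(0,u) ∉ Alg♭⁰`;
* `not_fact_gysin_of_tr_ne_zero` — **F7 `Fact_gysin` fails** if moreover `∫ ω ≠ 0` for such an `ω` (the projection formula
  would give `0 = p_{Y*}(p_Y^*(0,u) ∪ p_{Y′}^*ω) = (∫ω)·(0,u)`); conversely `fact_gysin_of_tr_eq_zero` — if ALL traces of `U`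
  vanish (as in the exterior toy model) then F7 holds in `U♭⁰` vacuously (`p_{Y*} := 0`).

Consequently (toy instance `HodgeCM.Model.Toy.ToyPadH0FundDescent`): F7d, F7d-B and `Fact_unitH0` are each independent of
`ModelAxioms ∧ N1–N4 ∧ F4 ∧ F5 ∧ F7 ∧ Fact_dimProd ∧ W_RK4 ∧ PohlmannSpan ∧ Qw8MilnePos`; in particular the kernel derivation
`gysinDescent_of_gysin : Fact_gysin → Fact_trTopCM → Fact_gysinDescent` genuinely needs its trace-injectivity input.
Nothing is cited; Lean + Mathlib axioms only.
-/

noncomputable section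

namespace HodgeCM

open Literature.AlgebraicGeometry.Motives (CMType HodgeStructure)

namespace Universe

namespace PadH0Fund

variable {U : Universe}

set_option smartUnfolding false in
/-- **`Fact_unitH0` FAILS in `U♭⁰`** as soon as some `H⁰(A′, ℚ) ≠ 0`: for `u ≠ 0` in `H⁰(A_Φ)` the classes `(u,0)` and `(0,u)`
of `H♭⁰(A_Φ)` cannot both be multiples of one class. -/
theorem not_fact_unitH0 (h0 : U.CMProdH0Nontrivial) : ¬ (U.padH0 U.padDatumH0).Fact_unitH0 := by
  rintro ⟨one, -, -, hspan⟩
  obtain ⟨F, -, -, f, -, -⟩ := faceHypothesesInhabited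
  let Θ : Fin (0 + 1) → CMType F := fun _ => f.Φ
  haveI : Nontrivial (U.Coh (U.cmProd F Θ) 0) := h0 F 0 Θ
  obtain ⟨u, hu⟩ := exists_ne (0 : U.Coh (U.cmProd F Θ) 0)
  obtain ⟨r, hr⟩ := hspan F 0 Θ (PadH0.ofU U.padDatumH0 ((U.padH0 U.padDatumH0).cmProd F Θ) 0 u)
  obtain ⟨s, hs⟩ := hspan F 0 Θ (PadH0.ofPad U.padDatumH0 ((U.padH0 U.padDatumH0).cmProd F Θ) 0 u)
  have h1 := congrArg (PadH0.toU U.padDatumH0 ((U.padH0 U.padDatumH0).cmProd F Θ) 0) hr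
  have h2 := congrArg (PadH0.padOf U.padDatumH0 ((U.padH0 U.padDatumH0).cmProd F Θ) 0) hr
  have h4 := congrArg (PadH0.padOf U.padDatumH0 ((U.padH0 U.padDatumH0).cmProd F Θ) 0) hs
  rw [PadH0.toU_ofU, map_smul] at h1
  rw [PadH0.padOf_ofU, map_smul] at h2
  rw [PadH0.padOf_ofPad_zero, map_smul] at h4
  have hr0 : r ≠ 0 := by
    rintro rfl
    rw [zero_smul] at h1
    exact hu h1
  have hp : PadH0.padOf U.padDatumH0 ((U.padH0 U.padDatumH0).cmProd F Θ) 0 (one _) = 0 :=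
    (smul_eq_zero.mp h2.symm).resolve_left hr0
  rw [hp, smul_zero] at h4
  exact hu h4

section Descent

variable (M : U.ModelAxioms) (hd : U.Fact_dimProd) (h0 : U.CMProdH0Nontrivial)
include M hd h0

set_option smartUnfolding false in
/-- **F7d = M41 `Fact_gysinDescent` FAILS in `U♭⁰`** (given `ModelAxioms`, `Fact_dimProd`, some `H⁰(A′, ℚ) ≠ 0`, and a nonzero
rational top class on some block `Y′ = ∏_{i ≤ m} A_{Ξ_{n+1+i}}`): clause (a) fails in degree `0` for the pad vector `(0,u)`. -/
theorem not_fact_gysinDescent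
    (hω : ∃ (F : CMField) (n m : ℕ) (Ξ : Fin (n + 1 + (m + 1)) → CMType F)
      (ω : U.Coh (U.cmProd F (blkB Ξ)) (2 * U.dim (U.cmProd F (blkB Ξ)))), ω ≠ 0) :
    ¬ (U.padH0 U.padDatumH0).Fact_gysinDescent := by
  intro h
  obtain ⟨F, n, m, Ξ, ω, hω0⟩ := hω
  have Mb := modelAxioms M hd
  obtain ⟨pA, pB, hP⟩ := (U.padH0 U.padDatumH0).blockPair_exists Mb.pull_id Mb.pull_comp Mb.lift F n m Ξ
  let ω' : (U.padH0 U.padDatumH0).Coh ((U.padH0 U.padDatumH0).cmProd F (blkB Ξ))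
      (2 * (U.padH0 U.padDatumH0).dim ((U.padH0 U.padDatumH0).cmProd F (blkB Ξ))) :=
    PadH0.ofU U.padDatumH0 ((U.padH0 U.padDatumH0).cmProd F (blkB Ξ)) (2 * (U.padH0 U.padDatumH0).dim ((U.padH0 U.padDatumH0).cmProd F (blkB Ξ))) ω
  have hω' : ω' ≠ 0 := fun h' =>
    hω0 (PadH0.ofU_injective (D := U.padDatumH0) ((U.padH0 U.padDatumH0).cmProd F (blkB Ξ)) (2 * (U.padH0 U.padDatumH0).dim ((U.padH0 U.padDatumH0).cmProd F (blkB Ξ)))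
      (h'.trans (map_zero _).symm))
  haveI : Nontrivial (U.Coh (U.cmProd F (blkA Ξ)) 0) := h0 F n (blkA Ξ)
  obtain ⟨u, hu⟩ := exists_ne (0 : U.Coh (U.cmProd F (blkA Ξ)) 0)
  have hcup : (U.padH0 U.padDatumH0).cup ((U.padH0 U.padDatumH0).cmProd F Ξ) 0 (2 * (U.padH0 U.padDatumH0).dim ((U.padH0 U.padDatumH0).cmProd F (blkB Ξ)))
      ((U.padH0 U.padDatumH0).pull pA 0 (PadH0.ofPad U.padDatumH0 ((U.padH0 U.padDatumH0).cmProd F (blkA Ξ)) 0 u))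
      ((U.padH0 U.padDatumH0).pull pB (2 * (U.padH0 U.padDatumH0).dim ((U.padH0 U.padDatumH0).cmProd F (blkB Ξ))) ω') = 0 := by
    rw [PadH0.cup_def, PadH0.toU_pull (D := U.padDatumH0) pA, PadH0.toU_ofPad, map_zero, map_zero, LinearMap.zero_apply,
      map_zero]
  have ha := (h F n m Ξ pA pB hP ω' hω').1 0 _ hcup
  have hu' := congrArg (PadH0.padOf U.padDatumH0 ((U.padH0 U.padDatumH0).cmProd F (blkA Ξ)) 0) ha
  rw [PadH0.padOf_ofPad_zero, map_zero] at hu'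
  exact hu hu'

set_option smartUnfolding false in
/-- **Clause (b) alone, `Fact_gysinDescentB`, FAILS in `U♭⁰`** under the same hypotheses: `p_Y^*(0,u) ∪ p_{Y′}^*ω = 0` is
algebraic, `(0,u)` is not. -/
theorem not_fact_gysinDescentB
    (hω : ∃ (F : CMField) (n m : ℕ) (Ξ : Fin (n + 1 + (m + 1)) → CMType F)
      (ω : U.Coh (U.cmProd F (blkB Ξ)) (2 * U.dim (U.cmProd F (blkB Ξ)))), ω ≠ 0) :
    ¬ (U.padH0 U.padDatumH0).Fact_gysinDescentB := by
  intro h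
  obtain ⟨F, n, m, Ξ, ω, hω0⟩ := hω
  have Mb := modelAxioms M hd
  obtain ⟨pA, pB, hP⟩ := (U.padH0 U.padDatumH0).blockPair_exists Mb.pull_id Mb.pull_comp Mb.lift F n m Ξ
  let ω' : (U.padH0 U.padDatumH0).Coh ((U.padH0 U.padDatumH0).cmProd F (blkB Ξ))
      (2 * (U.padH0 U.padDatumH0).dim ((U.padH0 U.padDatumH0).cmProd F (blkB Ξ))) :=
    PadH0.ofU U.padDatumH0 ((U.padH0 U.padDatumH0).cmProd F (blkB Ξ)) (2 * (U.padH0 U.padDatumH0).dim ((U.padH0 U.padDatumH0).cmProd F (blkB Ξ))) ω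
  have hω' : ω' ≠ 0 := fun h' =>
    hω0 (PadH0.ofU_injective (D := U.padDatumH0) ((U.padH0 U.padDatumH0).cmProd F (blkB Ξ)) (2 * (U.padH0 U.padDatumH0).dim ((U.padH0 U.padDatumH0).cmProd F (blkB Ξ)))
      (h'.trans (map_zero _).symm))
  haveI : Nontrivial (U.Coh (U.cmProd F (blkA Ξ)) 0) := h0 F n (blkA Ξ)
  obtain ⟨u, hu⟩ := exists_ne (0 : U.Coh (U.cmProd F (blkA Ξ)) 0)
  have hcup : (U.padH0 U.padDatumH0).cup ((U.padH0 U.padDatumH0).cmProd F Ξ) (2 * 0) (2 * (U.padH0 U.padDatumH0).dim ((U.padH0 U.padDatumH0).cmProd F (blkB Ξ)))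
      ((U.padH0 U.padDatumH0).pull pA (2 * 0)
        (PadH0.ofPad U.padDatumH0 ((U.padH0 U.padDatumH0).cmProd F (blkA Ξ)) (2 * 0) u))
      ((U.padH0 U.padDatumH0).pull pB (2 * (U.padH0 U.padDatumH0).dim ((U.padH0 U.padDatumH0).cmProd F (blkB Ξ))) ω') = 0 := by
    rw [PadH0.cup_def, PadH0.toU_pull (D := U.padDatumH0) pA, PadH0.toU_ofPad, map_zero, map_zero, LinearMap.zero_apply,
      map_zero]
  have hb := h F n m Ξ pA pB hP ω' hω' 0
    (PadH0.ofPad U.padDatumH0 ((U.padH0 U.padDatumH0).cmProd F (blkA Ξ)) (2 * 0) u)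
    (by rw [hcup, map_zero]; exact Submodule.zero_mem _)
  exact hu ((PadH0.ofPad_mem_alg_iff (D := U.padDatumH0) ((U.padH0 U.padDatumH0).cmProd F (blkA Ξ)) u).mp hb)

set_option smartUnfolding false in
/-- **F7 `Fact_gysin` FAILS in `U♭⁰` whenever some block `Y′` carries a rational top class of nonzero trace** (besides
`ModelAxioms`, `Fact_dimProd`, some `H⁰(A′, ℚ) ≠ 0`): the projection formula in degree `0` would read `0 = (∫ω)·(0,u)`. -/
theorem not_fact_gysin_of_tr_ne_zero
    (hω : ∃ (F : CMField) (n m : ℕ) (Ξ : Fin (n + 1 + (m + 1)) → CMType F)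
      (ω : U.Coh (U.cmProd F (blkB Ξ)) (2 * U.dim (U.cmProd F (blkB Ξ)))), U.tr _ _ ω ≠ 0) :
    ¬ (U.padH0 U.padDatumH0).Fact_gysin := by
  intro h
  obtain ⟨F, n, m, Ξ, ω, hω0⟩ := hω
  have Mb := modelAxioms M hd
  obtain ⟨pA, pB, hP⟩ := (U.padH0 U.padDatumH0).blockPair_exists Mb.pull_id Mb.pull_comp Mb.lift F n m Ξ
  obtain ⟨gy, -, hgy⟩ := h F n m Ξ pA pB hP
  let ω' : (U.padH0 U.padDatumH0).Coh ((U.padH0 U.padDatumH0).cmProd F (blkB Ξ))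
      (2 * (U.padH0 U.padDatumH0).dim ((U.padH0 U.padDatumH0).cmProd F (blkB Ξ))) :=
    PadH0.ofU U.padDatumH0 ((U.padH0 U.padDatumH0).cmProd F (blkB Ξ)) (2 * (U.padH0 U.padDatumH0).dim ((U.padH0 U.padDatumH0).cmProd F (blkB Ξ))) ω
  haveI : Nontrivial (U.Coh (U.cmProd F (blkA Ξ)) 0) := h0 F n (blkA Ξ)
  obtain ⟨u, hu⟩ := exists_ne (0 : U.Coh (U.cmProd F (blkA Ξ)) 0)
  have hcup : (U.padH0 U.padDatumH0).cup ((U.padH0 U.padDatumH0).cmProd F Ξ) 0 (2 * (U.padH0 U.padDatumH0).dim ((U.padH0 U.padDatumH0).cmProd F (blkB Ξ)))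
      ((U.padH0 U.padDatumH0).pull pA 0 (PadH0.ofPad U.padDatumH0 ((U.padH0 U.padDatumH0).cmProd F (blkA Ξ)) 0 u))
      ((U.padH0 U.padDatumH0).pull pB (2 * (U.padH0 U.padDatumH0).dim ((U.padH0 U.padDatumH0).cmProd F (blkB Ξ))) ω') = 0 := by
    rw [PadH0.cup_def, PadH0.toU_pull (D := U.padDatumH0) pA, PadH0.toU_ofPad, map_zero, map_zero, LinearMap.zero_apply,
      map_zero]
  have key := hgy 0 (PadH0.ofPad U.padDatumH0 ((U.padH0 U.padDatumH0).cmProd F (blkA Ξ)) 0 u) ω'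
  rw [hcup, map_zero, PadH0.tr_apply, PadH0.toU_ofU] at key
  have hu' := congrArg (PadH0.padOf U.padDatumH0 ((U.padH0 U.padDatumH0).cmProd F (blkA Ξ)) 0) key
  rw [map_zero, map_smul, PadH0.padOf_ofPad_zero] at hu'
  exact hω0 ((smul_eq_zero.mp hu'.symm).resolve_right hu)

end Descent

/-- Conversely, **if every trace of `U` vanishes, F7 holds in `U♭⁰`** (vacuously: `p_{Y*} := 0` is a Gysin map). -/
theorem fact_gysin_of_tr_eq_zero (htr : ∀ (X : U.Var) (k : ℕ), U.tr X k = 0) : (U.padH0 U.padDatumH0).Fact_gysin := by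
  intro F n m Ξ pA pB _
  refine ⟨fun _ => 0, fun p z _ => Submodule.zero_mem _, fun k e ω => ?_⟩
  rw [LinearMap.zero_apply, PadH0.tr_apply, htr, LinearMap.zero_apply, zero_smul]


end PadH0Fund

end Universe

end HodgeCM

end
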